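import Summits.NavierStokesRegularity.FunctionalMining.StrainSqTransport
import Summits.NavierStokesRegularity.FunctionalMining.C1WeightIntegral
import Literature.Analysis.FunctionSpaces.TorusChainRule
import Literature.Analysis.FunctionSpaces.TorusLowOrderLeibniz
import HarnessLib

/-!
# FunctionalMining — the weighted strain balance with a `C¹` weight

Search for candidate a priori estimates; no regularity claim. Cell `pub-nsfunc`, prove seat
(gen 10). The smooth-weight strain balance `d/dt ∫ Ψ(|S|²)`
(`GradientTensor.hasDerivWithinAt_integral_comp_strainSqAt`, file `StrainWeightedBalance`) asks for
`Ψ` of class `C^∞` near the values of `|S|²`. The strain moments `∫|S|^q = ∫ (|S|²)^{q/2}` of the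
K0 rows `ES.absS.q|T_LD|G1` with non-integer `q/2` (SIEVELD §3.3: `q = 3`, and every real `q > 2`)
have the weight `s ↦ s^{q/2}`, which is only `C¹` at `s = 0`. Since the balance keeps the viscous
term as printed (`∑ᵢⱼ Sᵢⱼ (∂ᵢΔu)ⱼ`, no integration by parts), a `C¹` weight is all it needs —
exactly as for the vorticity twin (tree `TorusWeightedVorticityBalanceC1`, Gibbon 2010 App. A).

For a classical solution of `∂ₜu + (u·∇)u = νΔu − ∇p + f`, `div u = 0` on `T^d × [a, b]` and `Ψ`
of class `C¹` on an open set containing the values of `|S|²`: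

`d/dt ∫ Ψ(|S|²) = 2ν ∫ Ψ'(|S|²) ∑ᵢⱼ Sᵢⱼ (∂ᵢΔu)ⱼ − 2 ∫ Ψ'(|S|²) ∑ᵢⱼ Sᵢⱼ ∂ᵢ∂ⱼp`
`                 + 2 ∫ Ψ'(|S|²) ∑ᵢⱼ Sᵢⱼ (∂ᵢf)ⱼ − 2 ∫ Ψ'(|S|²) ∑ᵢⱼₖ Sᵢⱼ (∂ᵢu)ₖ (∂ₖu)ⱼ`

(one-sided, within `[a, b]`; Majda–Bertozzi 2002 (1.29) contracted with `2Ψ'(|S|²)S`; the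
transport term `∫ Ψ'(|S|²)(u·∇)|S|² = ∫ div(Ψ(|S|²) u) = 0` by the `C¹` divergence theorem;
differentiation under the integral by `C1Weight.hasDerivWithinAt_integral_comp_of_contDiffOn_one`).

## Main statements

* `GradientTensor.integral_deriv_comp_strainSqAt_mul_convect_eq_zero_of_contDiffOn_one` — the
  transport term vanishes (`C¹` weight).
* `GradientTensor.hasDerivWithinAt_integral_comp_strainSqAt_of_contDiffOn_one` — the balance.
-/

noncomputable section

open MeasureTheory Finset Set Filter Topology
open scoped InnerProductSpace RealInnerProductSpace ContDiff

namespace Summit.NavierStokesRegularity.FunctionalMining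

open Literature.Analysis.FunctionSpaces Literature.Analysis.FluidPDE

/-! ## The strain balance with a `C¹` weight -/



namespace GradientTensor

variable {d : Type*} [Fintype d] [DecidableEq d]

/-- **Transport term with a `C¹` weight**: for smooth divergence-free `v` and `g` of class `C¹` on
an open set containing the values of `|S|²`,
`∫ g'(|S|²) ∑ᵢⱼ Sᵢⱼ ∑ₖ vₖ ∂ₖ(∂ᵢv)ⱼ = ½ ∫ (v·∇)(g ∘ |S|²) = ½ ∫ div(g(|S|²) v) = 0`
(`C¹` divergence theorem on the torus). [folklore] -/
theorem integral_deriv_comp_strainSqAt_mul_convect_eq_zero_of_contDiffOn_one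
    {v : UnitAddTorus d → EuclideanSpace ℝ d} (hv : Torus.IsSmooth v) (hdiv : Torus.IsDivFree v)
    {g : ℝ → ℝ} {U : Set ℝ} (hU : IsOpen U) (hg : ContDiffOn ℝ 1 g U)
    (hmaps : ∀ x, torusStrainSqAt v x ∈ U) :
    ∫ x, deriv g (torusStrainSqAt v x) * ∑ i, ∑ j,
      (Torus.partialDeriv j v x i + Torus.partialDeriv i v x j) / 2 *
        ∑ k, v x k * Torus.partialDeriv k (Torus.partialDeriv i v) x j = 0 := by
  have hQ : Torus.IsSmooth (torusStrainSqAt v) := isSmooth_strainSqAt hv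
  have hQ1 : Torus.IsContDiff 1 (torusStrainSqAt v) := hQ.isContDiff (by simp)
  have hv1 : Torus.IsContDiff 1 v := hv.isContDiff (by simp)
  -- `θ = g ∘ |S|²` is `C¹`, and so is `θ • v`
  have hθ : Torus.IsContDiff 1 (fun y => g (torusStrainSqAt v y)) := by
    unfold Torus.IsContDiff at hQ1 ⊢
    exact hg.comp_contDiff hQ1 fun z => hmaps _
  have hθv : Torus.IsContDiff 1 (fun y => g (torusStrainSqAt v y) • v y) := by
    unfold Torus.IsContDiff at hθ hv1 ⊢
    exact hθ.smul hv1
  -- pointwise: the integrand is `½ div(θ v)`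
  have hpt : ∀ x, deriv g (torusStrainSqAt v x) * ∑ i, ∑ j,
      (Torus.partialDeriv j v x i + Torus.partialDeriv i v x j) / 2 *
        ∑ k, v x k * Torus.partialDeriv k (Torus.partialDeriv i v) x j =
      2⁻¹ * Torus.divergence (fun y => g (torusStrainSqAt v y) • v y) x := by
    intro x
    rw [Torus.divergence_smul hθ hv1 x, hdiv x, mul_zero, zero_add]
    have hgd : DifferentiableAt ℝ g (torusStrainSqAt v x) :=
      (hg.differentiableOn (by simp)).differentiableAt (hU.mem_nhds (hmaps x))
    have hk : ∀ k, Torus.partialDeriv k (fun y => g (torusStrainSqAt v y)) x =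
        deriv g (torusStrainSqAt v x) * Torus.partialDeriv k (torusStrainSqAt v) x :=
      fun k => Torus.partialDeriv_comp_of_differentiableAt hgd hQ1 k
    simp_rw [hk, partialDeriv_strainSqAt hv]
    -- both sides are the same triple sum `∑ᵢⱼₖ G Eᵢⱼ vₖ ∂ₖ(∂ᵢv)ⱼ`
    have lhs : deriv g (torusStrainSqAt v x) * ∑ i, ∑ j,
        (Torus.partialDeriv j v x i + Torus.partialDeriv i v x j) / 2 *
          ∑ k, v x k * Torus.partialDeriv k (Torus.partialDeriv i v) x j =
        ∑ i, ∑ j, ∑ k, deriv g (torusStrainSqAt v x) *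
          ((Torus.partialDeriv j v x i + Torus.partialDeriv i v x j) / 2) *
            (v x k * Torus.partialDeriv k (Torus.partialDeriv i v) x j) := by
      simp only [Finset.mul_sum]
      exact Finset.sum_congr rfl fun i _ => Finset.sum_congr rfl fun j _ =>
        Finset.sum_congr rfl fun k _ => by ring
    have rhs : 2⁻¹ * ∑ k, v x k * (deriv g (torusStrainSqAt v x) *
        (2 * ∑ i, ∑ j, (Torus.partialDeriv j v x i + Torus.partialDeriv i v x j) / 2 *
          Torus.partialDeriv k (Torus.partialDeriv i v) x j)) =
        ∑ i, ∑ j, ∑ k, deriv g (torusStrainSqAt v x) *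
          ((Torus.partialDeriv j v x i + Torus.partialDeriv i v x j) / 2) *
            (v x k * Torus.partialDeriv k (Torus.partialDeriv i v) x j) := by
      simp only [Finset.mul_sum]
      rw [Finset.sum_comm]
      refine Finset.sum_congr rfl fun i _ => ?_
      rw [Finset.sum_comm]
      exact Finset.sum_congr rfl fun j _ => Finset.sum_congr rfl fun k _ => by ring
    rw [lhs, rhs]
  simp_rw [hpt]
  rw [integral_const_mul, Torus.integral_divergence_eq_zero_of_isContDiff hθv, mul_zero]

/-- **The weighted strain balance with a `C¹` weight along classical Navier–Stokes solutions on
`T^d`.** Let `(u, p)` be a classical solution of `∂ₜu + (u·∇)u = νΔu − ∇p + f`, `div u = 0` on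
`T^d × [a, b]` (`a < b`) and `Ψ` be of class `C¹` on an open `U ⊆ ℝ` containing every
`|S(u(s))(x)|²`, `s ∈ [a, b]` (`|S|² = torusStrainSqAt`, `Sᵢⱼ = ((∂ⱼu)ᵢ + (∂ᵢu)ⱼ)/2`). Then
`s ↦ ∫ Ψ(|S(s)|²)` has, at every `t ∈ [a, b]`, the one-sided derivative
`2ν∫Ψ'(|S|²)∑ᵢⱼSᵢⱼ(∂ᵢΔu)ⱼ − 2∫Ψ'(|S|²)∑ᵢⱼSᵢⱼ∂ᵢ∂ⱼp + 2∫Ψ'(|S|²)∑ᵢⱼSᵢⱼ(∂ᵢf)ⱼ − 2∫Ψ'(|S|²)∑ᵢⱼSᵢⱼ∑ₖ(∂ᵢu)ₖ(∂ₖu)ⱼ`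
within `[a, b]` (the transport term vanishes since `div u = 0`; Majda–Bertozzi 2002 (1.29),
the symmetric part `D𝒟/Dt + 𝒟² + Ω² = −P + νΔ𝒟 + (∇f)_sym` contracted with `2Ψ'(|𝒟|²)𝒟`; the
`C^∞`-weight version is `hasDerivWithinAt_integral_comp_strainSqAt`).
[cite: MajdaBertozziCUP2002, §1.4 eq. (1.29)] -/
theorem hasDerivWithinAt_integral_comp_strainSqAt_of_contDiffOn_one
    {a b ν : ℝ} {f u : ℝ → UnitAddTorus d → EuclideanSpace ℝ d} {p : ℝ → UnitAddTorus d → ℝ}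
    (h : Torus.IsClassicalNSSolutionOn (Icc a b) ν f u p) (hab : a < b) {Ψ : ℝ → ℝ} {U : Set ℝ}
    (hUo : IsOpen U) (hΨ : ContDiffOn ℝ 1 Ψ U)
    (hmaps : ∀ s ∈ Icc a b, ∀ x, torusStrainSqAt (u s) x ∈ U) {t : ℝ} (ht : t ∈ Icc a b) :
    HasDerivWithinAt (fun s => ∫ x, Ψ (torusStrainSqAt (u s) x))
      (2 * ν * (∫ x, deriv Ψ (torusStrainSqAt (u t) x) * ∑ i, ∑ j,
          (Torus.partialDeriv j (u t) x i + Torus.partialDeriv i (u t) x j) / 2 *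
            Torus.partialDeriv i (Torus.laplacian (u t)) x j) -
        2 * (∫ x, deriv Ψ (torusStrainSqAt (u t) x) * ∑ i, ∑ j,
          (Torus.partialDeriv j (u t) x i + Torus.partialDeriv i (u t) x j) / 2 *
            Torus.partialDeriv i (Torus.partialDeriv j (p t)) x) +
        2 * (∫ x, deriv Ψ (torusStrainSqAt (u t) x) * ∑ i, ∑ j,
          (Torus.partialDeriv j (u t) x i + Torus.partialDeriv i (u t) x j) / 2 *
            Torus.partialDeriv i (f t) x j) -
        2 * ∫ x, deriv Ψ (torusStrainSqAt (u t) x) * ∑ i, ∑ j,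
          (Torus.partialDeriv j (u t) x i + Torus.partialDeriv i (u t) x j) / 2 *
            ∑ k, Torus.partialDeriv i (u t) x k * Torus.partialDeriv k (u t) x j)
      (Icc a b) t := by
  have hU : UniqueDiffOn ℝ (Icc a b) := uniqueDiffOn_Icc hab
  have hu : Torus.IsSmoothSpaceTimeOn (Icc a b) u := h.smooth_velocity
  have hut : Torus.IsSmooth (u t) := hu.isSmooth_slice ht
  have hdivt : Torus.IsDivFree (u t) := h.divFree t ht
  have hpt' : Torus.IsSmooth (p t) := h.smooth_pressure.isSmooth_slice ht
  have hQ : Torus.IsSmooth (torusStrainSqAt (u t)) := isSmooth_strainSqAt hut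
  have hΨ'c : ContinuousOn (deriv Ψ) U := hΨ.continuousOn_deriv_of_isOpen hUo le_rfl
  have hGc : Continuous (fun y => deriv Ψ (torusStrainSqAt (u t) y)) :=
    hΨ'c.comp_continuous hQ.continuous (hmaps t ht)
  have hA : Torus.IsSmooth (Torus.timeDerivWithin (Icc a b) u t) := hu.isSmooth_timeDerivWithin hU ht
  -- the forcing slice is smooth (momentum equation)
  have hf : Torus.IsSmooth (f t) := by
    have hfun : f t = fun y => Torus.timeDerivWithin (Icc a b) u t y + Torus.convect (u t) (u t) y -
        ν • Torus.laplacian (u t) y + Torus.gradient (p t) y := by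
      funext y
      have := h.momentum t ht y
      rw [this]
      abel
    rw [hfun]
    exact ((hA.add (hut.convect hut)).sub (hut.laplacian.smul ν)).add hpt'.gradient
  -- Step 1: differentiate under the integral sign (`C¹` outer function)
  have hQst : Torus.IsSmoothSpaceTimeOn (Icc a b) (fun s y => torusStrainSqAt (u s) y) :=
    isSmoothSpaceTimeOn_strainSqAt hu hU
  have hD := C1Weight.hasDerivWithinAt_integral_comp_of_contDiffOn_one hab hQst hUo hΨ hmaps ht
  refine hD.congr_deriv ?_
  -- Step 2: the time derivative of `|S|²` with the momentum equation substituted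
  have hQt : ∀ x, Torus.timeDerivWithin (Icc a b) (fun s y => torusStrainSqAt (u s) y) t x = _ :=
    fun x => timeDerivWithin_strainSqAt h hab ht x
  simp_rw [hQt]
  -- Step 3: names for the densities and the split of the integral
  set G : UnitAddTorus d → ℝ := fun y => deriv Ψ (torusStrainSqAt (u t) y) with hGdef
  set E : d → d → UnitAddTorus d → ℝ := fun i j y =>
    (Torus.partialDeriv j (u t) y i + Torus.partialDeriv i (u t) y j) / 2 with hEdef
  obtain ⟨T1, hT1⟩ : ∃ T : UnitAddTorus d → ℝ, T = fun y => ∑ i, ∑ j, E i j y *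
    Torus.partialDeriv i (Torus.laplacian (u t)) y j := ⟨_, rfl⟩
  obtain ⟨T2, hT2⟩ : ∃ T : UnitAddTorus d → ℝ, T = fun y => ∑ i, ∑ j, E i j y *
    Torus.partialDeriv i (Torus.partialDeriv j (p t)) y := ⟨_, rfl⟩
  obtain ⟨T3, hT3⟩ : ∃ T : UnitAddTorus d → ℝ, T = fun y => ∑ i, ∑ j, E i j y *
    Torus.partialDeriv i (f t) y j := ⟨_, rfl⟩
  obtain ⟨T4, hT4⟩ : ∃ T : UnitAddTorus d → ℝ, T = fun y => ∑ i, ∑ j, E i j y *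
    ∑ k, Torus.partialDeriv i (u t) y k * Torus.partialDeriv k (u t) y j := ⟨_, rfl⟩
  obtain ⟨T5, hT5⟩ : ∃ T : UnitAddTorus d → ℝ, T = fun y => ∑ i, ∑ j, E i j y *
    ∑ k, u t y k * Torus.partialDeriv k (Torus.partialDeriv i (u t)) y j := ⟨_, rfl⟩
  have hEs : ∀ i j, Torus.IsSmooth (E i j) := fun i j => isSmooth_strainEntry hut i j
  have hs2 : ∀ {g : d → d → UnitAddTorus d → ℝ}, (∀ i j, Torus.IsSmooth (g i j)) →
      Torus.IsSmooth (fun y => ∑ i, ∑ j, g i j y) := fun hg =>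
    ContDiff.sum fun i _ => ContDiff.sum fun j _ => hg i j
  have hT1s : Torus.IsSmooth T1 := by
    rw [hT1]; exact hs2 fun i j => (hEs i j).mul ((hut.laplacian.partialDeriv i).apply j)
  have hT2s : Torus.IsSmooth T2 := by
    rw [hT2]; exact hs2 fun i j => (hEs i j).mul ((hpt'.partialDeriv j).partialDeriv i)
  have hT3s : Torus.IsSmooth T3 := by
    rw [hT3]; exact hs2 fun i j => (hEs i j).mul ((hf.partialDeriv i).apply j)
  have hT4s : Torus.IsSmooth T4 := by
    rw [hT4]; exact hs2 fun i j => (hEs i j).mul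
      (ContDiff.sum fun k _ => ((hut.partialDeriv i).apply k).mul ((hut.partialDeriv k).apply j))
  have hT5s : Torus.IsSmooth T5 := by
    rw [hT5]; exact hs2 fun i j => (hEs i j).mul
      (ContDiff.sum fun k _ => (hut.apply k).mul (((hut.partialDeriv i).partialDeriv k).apply j))
  have e1 : ∀ x, G x * (2 * ∑ i, ∑ j, E i j x *
      (ν * Torus.partialDeriv i (Torus.laplacian (u t)) x j -
        Torus.partialDeriv i (Torus.partialDeriv j (p t)) x + Torus.partialDeriv i (f t) x j -
        (∑ k, Torus.partialDeriv i (u t) x k * Torus.partialDeriv k (u t) x j) -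
        ∑ k, u t x k * Torus.partialDeriv k (Torus.partialDeriv i (u t)) x j)) =
      2 * ν * (G x * T1 x) - 2 * (G x * T2 x) + 2 * (G x * T3 x) - 2 * (G x * T4 x) -
        2 * (G x * T5 x) := by
    intro x
    rw [hT1, hT2, hT3, hT4, hT5]
    simp only [mul_sub, mul_add, Finset.sum_sub_distrib, Finset.sum_add_distrib, Finset.mul_sum]
    refine congrArg₂ (· - ·) (congrArg₂ (· - ·) (congrArg₂ (· + ·) (congrArg₂ (· - ·) ?_ ?_) ?_) ?_) ?_
    all_goals
      refine Finset.sum_congr rfl fun i _ => Finset.sum_congr rfl fun j _ => ?_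
      ring
  have iT : ∀ {T : UnitAddTorus d → ℝ}, Torus.IsSmooth T → ∀ c : ℝ,
      Integrable (fun x => c * (G x * T x)) := fun hT c =>
    ((hGc.mul hT.continuous).integrable_unitAddTorus).const_mul c
  have i1 := iT hT1s (2 * ν)
  have i2 := iT hT2s 2
  have i3 := iT hT3s 2
  have i4 := iT hT4s 2
  have i5 := iT hT5s 2
  have hsplit : ∫ x, G x * (2 * ∑ i, ∑ j, E i j x *
      (ν * Torus.partialDeriv i (Torus.laplacian (u t)) x j -
        Torus.partialDeriv i (Torus.partialDeriv j (p t)) x + Torus.partialDeriv i (f t) x j -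
        (∑ k, Torus.partialDeriv i (u t) x k * Torus.partialDeriv k (u t) x j) -
        ∑ k, u t x k * Torus.partialDeriv k (Torus.partialDeriv i (u t)) x j)) =
      2 * ν * (∫ x, G x * T1 x) - 2 * (∫ x, G x * T2 x) + 2 * (∫ x, G x * T3 x) -
        2 * (∫ x, G x * T4 x) - 2 * ∫ x, G x * T5 x := by
    simp_rw [e1]
    have i12 : Integrable (fun x => 2 * ν * (G x * T1 x) - 2 * (G x * T2 x)) := i1.sub i2
    have i123 : Integrable (fun x => 2 * ν * (G x * T1 x) - 2 * (G x * T2 x) + 2 * (G x * T3 x)) :=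
      i12.add i3
    have i1234 : Integrable (fun x => 2 * ν * (G x * T1 x) - 2 * (G x * T2 x) + 2 * (G x * T3 x) -
        2 * (G x * T4 x)) := i123.sub i4
    rw [integral_sub i1234 i5, integral_sub i123 i4, integral_add i12 i3, integral_sub i1 i2,
      integral_const_mul, integral_const_mul, integral_const_mul, integral_const_mul,
      integral_const_mul]
  -- Step 4: the transport term vanishes
  have htrans : ∫ x, G x * T5 x = 0 := by
    rw [hT5]
    exact integral_deriv_comp_strainSqAt_mul_convect_eq_zero_of_contDiffOn_one hut hdivt hUo hΨ
      (hmaps t ht)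
  change ∫ x, G x * (2 * ∑ i, ∑ j, E i j x * _) = _
  rw [hsplit, htrans, mul_zero, sub_zero, hT1, hT2, hT3, hT4]

end GradientTensor

end Summit.NavierStokesRegularity.FunctionalMining
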